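import Literature.Geometry.Lorentzian.LandauLifshitzPseudotensor
import Mathlib.Analysis.Calculus.FDeriv.Symmetric

/-!
# Route EIHFluxBalance — `LLBalanceLaw`: the pointwise identities (clauses (i)–(iii))

Helper file for the support item `stmt-FinalStateConjecture-10189`
(`Summit.FinalStateConjecture.FinalStateConjecture.Theses.EIHFluxBalance.LLBalanceLaw`), the
Landau–Lifshitz balance law over `Literature.Geometry.Lorentzian.LandauLifshitzPseudotensor`.
That item is a conjunction of five clauses; this file proves the three POINTWISE ones, for a
field of bilinear forms `g` which is `C^∞` with `det (g_{μν}) ≠ 0` on an open set `U ⊆ E4`: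

* (i) `emComplex^{μν} = (−g)((8π)⁻¹ G^{μν} + t^{μν}_LL)` on `U` — algebra: `pseudotensor` is DEFINED
  by LL (96.7) as `(−g)⁻¹ emComplex − (8π)⁻¹ G` (`emComplex_eq_neg_metricDet_mul`);
* (ii) `Σ_ν ∂_ν emComplex^{μν} = 0` on `U` — LL (96.10), the identically conserved index:
  `emComplex^{μν} = Σ_α ∂_α h^{μνα}` with `h` antisymmetric in `(ν, α)` (`hField_swap`) and second
  partials symmetric (`sum_partialDeriv_emComplex_eq_zero`); the analytic input is that the
  components, the determinant, the adjugate and hence the inverse `g^{μν}`, the superpotential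
  and `h^{μνα}` are `C^∞` on `U` (`contDiffOn_upper`, `contDiffOn_hField`: Leibniz formula and
  Cramer's rule, no matrix norms);
* (iii) `Ric(g) = 0` on `U` ⇒ `Σ_ν ∂_ν ((−g) t^{μν}_LL) = 0` on `U` — then `G^{μν} = 0`, so
  `(−g) t^{μν} = emComplex^{μν}` on the open set `U` and (ii) applies
  (`sum_partialDeriv_neg_metricDet_mul_pseudotensor_eq_zero`).

`llBalanceLaw_pointwise` packages them in the literal shape of the item's first three conjuncts.
The two INTEGRAL clauses ((iv) `dP^μ/dt = −flux`, (v) the spherical shell formula for `μHE[2]`)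
are not touched here. Sources: Landau–Lifshitz, *The Classical Theory of Fields* §96,
(96.4)–(96.12) (key `LandauLifshitz1975`).
-/

noncomputable section

open Filter Set
open scoped Topology ContDiff Matrix

namespace Summit.FinalStateConjecture.FinalStateConjecture.Theorems

namespace LLBalance

open Literature.Geometry.Lorentzian Literature.Geometry.Lorentzian.LandauLifshitz

variable {g : E4 → E4 →L[ℝ] E4 →L[ℝ] ℝ} {U : Set E4}

/-! ### (i) The defining identity of the pseudotensor -/

/-- **LL (96.5)/(96.7) as an identity**: where `det (g_{μν}) ≠ 0`,
`Σ_α ∂_α h^{μνα} = (−g)((8π)⁻¹ G^{μν} + t^{μν}_LL)`, by the definition of `pseudotensor`.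
[cite: LandauLifshitz1975, §96 (96.7)] -/
theorem emComplex_eq_neg_metricDet_mul {x : E4} (hx : metricDet g x ≠ 0) (μ ν : Fin 4) :
    emComplex g x μ ν =
      -metricDet g x * ((8 * Real.pi)⁻¹ * einsteinUpper g x μ ν + pseudotensor g x μ ν) := by
  unfold pseudotensor
  have h : -metricDet g x ≠ 0 := neg_ne_zero.mpr hx
  field_simp
  ring

/-! ### Smoothness of the components, determinant, inverse, superpotential and `h^{μνα}` -/

/-- The metric components `y ↦ g_{μν}(y)` are `C^∞` on `U`. [folklore] -/
theorem contDiffOn_gram (hg : ContDiffOn ℝ ∞ g U) (μ ν : Fin 4) :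
    ContDiffOn ℝ ∞ (fun y ↦ gram g y μ ν) U := by
  simp only [gram_apply]
  exact (hg.clm_apply contDiffOn_const).clm_apply contDiffOn_const

/-- The determinant `y ↦ det (g_{μν}(y))` is `C^∞` on `U` (Leibniz formula). [folklore] -/
theorem contDiffOn_metricDet (hg : ContDiffOn ℝ ∞ g U) :
    ContDiffOn ℝ ∞ (fun y ↦ metricDet g y) U := by
  unfold metricDet
  simp_rw [Matrix.det_apply']
  exact ContDiffOn.sum fun σ _ ↦ contDiffOn_const.mul
    (contDiffOn_prod fun i _ ↦ contDiffOn_gram hg _ _)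

/-- The adjugate entries `y ↦ adj (g_{μν}(y))_{ij}` are `C^∞` on `U` (cofactors are determinants
of the components with one row replaced by a constant row). [folklore] -/
theorem contDiffOn_adjugate (hg : ContDiffOn ℝ ∞ g U) (i j : Fin 4) :
    ContDiffOn ℝ ∞ (fun y ↦ (gram g y).adjugate i j) U := by
  simp_rw [Matrix.adjugate_apply, Matrix.det_apply']
  refine ContDiffOn.sum fun σ _ ↦ contDiffOn_const.mul (contDiffOn_prod fun k _ ↦ ?_)
  by_cases h : (σ k : Fin 4) = j
  · simp_rw [Matrix.updateRow_apply, if_pos h]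
    exact contDiffOn_const
  · simp_rw [Matrix.updateRow_apply, if_neg h]
    exact contDiffOn_gram hg _ _

/-- **The inverse components `y ↦ g^{μν}(y)` are `C^∞` where `det (g_{μν}) ≠ 0`** (Cramer's rule
`A⁻¹ = (det A)⁻¹ adj A`). [folklore] -/
theorem contDiffOn_upper (hg : ContDiffOn ℝ ∞ g U) (hdet : ∀ x ∈ U, metricDet g x ≠ 0)
    (μ ν : Fin 4) : ContDiffOn ℝ ∞ (fun y ↦ upper g y μ ν) U := by
  have h : ∀ y, upper g y μ ν = (metricDet g y)⁻¹ * (gram g y).adjugate μ ν := by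
    intro y
    rw [upper, Matrix.inv_def, Matrix.smul_apply, smul_eq_mul, Ring.inverse_eq_inv]
    rfl
  simp_rw [h]
  exact ((contDiffOn_metricDet hg).inv hdet).mul (contDiffOn_adjugate hg μ ν)

/-- The superpotential `y ↦ H^{μανβ}(y)` is `C^∞` where `det (g_{μν}) ≠ 0`. [folklore] -/
theorem contDiffOn_superpotential (hg : ContDiffOn ℝ ∞ g U) (hdet : ∀ x ∈ U, metricDet g x ≠ 0)
    (μ α ν β : Fin 4) : ContDiffOn ℝ ∞ (fun y ↦ superpotential g y μ α ν β) U := by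
  unfold superpotential
  exact (contDiffOn_metricDet hg).neg.mul
    (((contDiffOn_upper hg hdet μ ν).mul (contDiffOn_upper hg hdet α β)).sub
      ((contDiffOn_upper hg hdet α ν).mul (contDiffOn_upper hg hdet μ β)))

/-- A coordinate partial derivative of a `C^∞` function on the open set `U` is `C^∞` on `U`.
[folklore] -/
theorem contDiffOn_partialDeriv (hU : IsOpen U) {f : E4 → ℝ} (hf : ContDiffOn ℝ ∞ f U)
    (β : Fin 4) : ContDiffOn ℝ ∞ (fun y ↦ partialDeriv β f y) U := by
  simp only [partialDeriv]
  exact (hf.fderiv_of_isOpen hU (by simp)).clm_apply contDiffOn_const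

/-- **LL's `h^{μνα}` is `C^∞` where `det (g_{μν}) ≠ 0`** (`h = (16π)⁻¹ Σ_β ∂_β H`).
[cite: LandauLifshitz1975, §96 (96.2)] -/
theorem contDiffOn_hField (hU : IsOpen U) (hg : ContDiffOn ℝ ∞ g U)
    (hdet : ∀ x ∈ U, metricDet g x ≠ 0) (μ ν α : Fin 4) :
    ContDiffOn ℝ ∞ (fun y ↦ hField g y μ ν α) U := by
  unfold hField
  exact contDiffOn_const.mul (ContDiffOn.sum fun β _ ↦
    contDiffOn_partialDeriv hU (contDiffOn_superpotential hg hdet μ β ν α) β)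

/-! ### (ii) The identically conserved index -/

/-- **LL (96.10) for the second index, identically**: `Σ_ν ∂_ν (Σ_α ∂_α h^{μνα}) = 0` on `U`,
because `h^{μνα} = −h^{μαν}` (`hField_swap`) while second partial derivatives of the `C^∞`
functions `h^{μνα}` commute (`ContDiffAt.isSymmSndFDerivAt`): the double sum equals its own
negative. [cite: LandauLifshitz1975, §96 (96.10)] -/
theorem sum_partialDeriv_emComplex_eq_zero (hU : IsOpen U) (hg : ContDiffOn ℝ ∞ g U)
    (hdet : ∀ x ∈ U, metricDet g x ≠ 0) {x : E4} (hx : x ∈ U) (μ : Fin 4) :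
    ∑ ν : Fin 4, partialDeriv ν (fun y ↦ emComplex g y μ ν) x = 0 := by
  set F : Fin 4 → Fin 4 → E4 → ℝ := fun ν α y ↦ hField g y μ ν α with hF
  have hFs : ∀ ν α, ContDiffOn ℝ ∞ (F ν α) U := fun ν α ↦ contDiffOn_hField hU hg hdet μ ν α
  have hFx : ∀ ν α, ContDiffAt ℝ ∞ (F ν α) x := fun ν α ↦ (hFs ν α).contDiffAt (hU.mem_nhds hx)
  have hdF : ∀ ν α, ContDiffOn ℝ ∞ (fderiv ℝ (F ν α)) U := fun ν α ↦
    (hFs ν α).fderiv_of_isOpen hU (by simp)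
  have hdFx : ∀ ν α, DifferentiableAt ℝ (fderiv ℝ (F ν α)) x := fun ν α ↦
    ((hdF ν α).contDiffAt (hU.mem_nhds hx)).differentiableAt (by simp)
  -- the summands as second derivatives
  have h2 : ∀ ν, partialDeriv ν (fun y ↦ emComplex g y μ ν) x =
      ∑ α : Fin 4, fderiv ℝ (fderiv ℝ (F ν α)) x (E4.basisVector ν) (E4.basisVector α) := by
    intro ν
    have hem : (fun y ↦ emComplex g y μ ν) =
        fun y ↦ ∑ α : Fin 4, fderiv ℝ (F ν α) y (E4.basisVector α) := rfl
    rw [partialDeriv, hem, fderiv_fun_sum fun α _ ↦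
      MetricCoord.differentiableAt_clm_apply_const (hdFx ν α) _]
    rw [_root_.sum_apply]
    exact Finset.sum_congr rfl fun α _ ↦ MetricCoord.fderiv_clm_apply_const (hdFx ν α) _ _
  -- antisymmetry in `(ν, α)` at the level of second derivatives
  have hanti : ∀ ν α, F ν α = fun y ↦ -F α ν y := fun ν α ↦ funext fun y ↦ hField_swap g y μ α ν
  have hneg : ∀ (ν α) (v w : E4), fderiv ℝ (fderiv ℝ (F ν α)) x v w =
      -fderiv ℝ (fderiv ℝ (F α ν)) x v w := by
    intro ν α v w
    have h1 : fderiv ℝ (F ν α) = fun z ↦ -fderiv ℝ (F α ν) z := by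
      rw [hanti ν α]
      funext z
      exact fderiv_fun_neg
    rw [h1, fderiv_fun_neg]
    rfl
  -- symmetry of second derivatives
  have hsymm : ∀ (ν α) (v w : E4), fderiv ℝ (fderiv ℝ (F ν α)) x v w =
      fderiv ℝ (fderiv ℝ (F ν α)) x w v := fun ν α v w ↦
    (hFx ν α).isSymmSndFDerivAt MetricCoord.two_le_infty v w
  simp_rw [h2]
  set S : ℝ := ∑ ν : Fin 4, ∑ α : Fin 4,
    fderiv ℝ (fderiv ℝ (F ν α)) x (E4.basisVector ν) (E4.basisVector α) with hS
  have hSS : S = -S := by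
    calc S = ∑ ν : Fin 4, ∑ α : Fin 4,
          -fderiv ℝ (fderiv ℝ (F α ν)) x (E4.basisVector α) (E4.basisVector ν) := by
            refine Finset.sum_congr rfl fun ν _ ↦ Finset.sum_congr rfl fun α _ ↦ ?_
            rw [hneg ν α, hsymm α ν]
      _ = -∑ α : Fin 4, ∑ ν : Fin 4,
          fderiv ℝ (fderiv ℝ (F α ν)) x (E4.basisVector α) (E4.basisVector ν) := by
            rw [Finset.sum_comm]
            simp only [Finset.sum_neg_distrib]
      _ = -S := by rw [hS]
  linarith

/-! ### (iii) Vacuum: the pseudotensor density is conserved -/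

/-- Where the Ricci components vanish, so does the contravariant Einstein tensor of the
components. [cite: LandauLifshitz1975, §95 (95.5)] -/
theorem einsteinUpper_eq_zero_of_ricAt_eq_zero {x : E4} (h : MetricCoord.ricAt g x = 0)
    (μ ν : Fin 4) : einsteinUpper g x μ ν = 0 := by
  have hr : ∀ α β : Fin 4, ricci g x α β = 0 := fun α β ↦ by
    simp [ricci, h]
  simp [einsteinUpper, scalar, hr]

/-- **LL (96.11) in vacuum**: if `Ric(g) = 0` and `det (g_{μν}) ≠ 0` on the open set `U`, then
`Σ_ν ∂_ν ((−g) t^{μν}_LL) = 0` on `U` — for then `(−g) t^{μν} = Σ_α ∂_α h^{μνα}` on `U`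
(`G^{μν} = 0` in the defining identity (96.7)), and the latter is identically conserved
(`sum_partialDeriv_emComplex_eq_zero`). [cite: LandauLifshitz1975, §96 (96.11)] -/
theorem sum_partialDeriv_neg_metricDet_mul_pseudotensor_eq_zero (hU : IsOpen U)
    (hg : ContDiffOn ℝ ∞ g U) (hdet : ∀ x ∈ U, metricDet g x ≠ 0)
    (hric : ∀ x ∈ U, MetricCoord.ricAt g x = 0) {x : E4} (hx : x ∈ U) (μ : Fin 4) :
    ∑ ν : Fin 4, partialDeriv ν (fun y ↦ -metricDet g y * pseudotensor g y μ ν) x = 0 := by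
  have heq : ∀ ν : Fin 4, (fun y ↦ -metricDet g y * pseudotensor g y μ ν) =ᶠ[𝓝 x]
      fun y ↦ emComplex g y μ ν := by
    intro ν
    filter_upwards [hU.mem_nhds hx] with y hy
    rw [pseudotensor, einsteinUpper_eq_zero_of_ricAt_eq_zero (hric y hy), mul_zero, sub_zero,
      ← mul_assoc, mul_inv_cancel₀ (neg_ne_zero.mpr (hdet y hy)), one_mul]
  have h : ∀ ν : Fin 4, partialDeriv ν (fun y ↦ -metricDet g y * pseudotensor g y μ ν) x =
      partialDeriv ν (fun y ↦ emComplex g y μ ν) x := fun ν ↦ by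
    rw [partialDeriv, partialDeriv, (heq ν).fderiv_eq]
  simp_rw [h]
  exact sum_partialDeriv_emComplex_eq_zero hU hg hdet hx μ

/-! ### Package: the first three conjuncts of `LLBalanceLaw` -/

/-- **Clauses (i)–(iii) of `Theses.EIHFluxBalance.LLBalanceLaw`, in its literal shape** (for a
smooth field of bilinear forms with `det < 0` on an open `U`; the symmetry hypothesis of the item
is not needed for these three clauses). Landau–Lifshitz §96, (96.7), (96.10), (96.11).
[cite: LandauLifshitz1975, §96 (96.10)–(96.11)] -/
theorem llBalanceLaw_pointwise (g : E4 → E4 →L[ℝ] E4 →L[ℝ] ℝ) (U : Set E4) (hU : IsOpen U)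
    (hg : ContDiffOn ℝ (⊤ : ℕ∞) g U) (hdet : ∀ x ∈ U, metricDet g x < 0) :
    (∀ x ∈ U, ∀ μ ν : Fin 4, emComplex g x μ ν =
      -metricDet g x * ((8 * Real.pi)⁻¹ * einsteinUpper g x μ ν + pseudotensor g x μ ν)) ∧
    (∀ x ∈ U, ∀ μ : Fin 4, ∑ ν : Fin 4, partialDeriv ν (fun y ↦ emComplex g y μ ν) x = 0) ∧
    ((∀ x ∈ U, MetricCoord.ricAt g x = 0) → ∀ x ∈ U, ∀ μ : Fin 4,
      ∑ ν : Fin 4, partialDeriv ν (fun y ↦ -metricDet g y * pseudotensor g y μ ν) x = 0) := by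
  have hdet' : ∀ x ∈ U, metricDet g x ≠ 0 := fun x hx ↦ (hdet x hx).ne
  exact ⟨fun x hx μ ν ↦ emComplex_eq_neg_metricDet_mul (hdet' x hx) μ ν,
    fun x hx μ ↦ sum_partialDeriv_emComplex_eq_zero hU hg hdet' hx μ,
    fun hric x hx μ ↦ sum_partialDeriv_neg_metricDet_mul_pseudotensor_eq_zero hU hg hdet' hric hx μ⟩

end LLBalance

end Summit.FinalStateConjecture.FinalStateConjecture.Theorems

end
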